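import Mathlib
import HarnessLib
import Summits.NavierStokesRegularity.NavierStokesRegularity.Theorems.TaylorModelRungThreeCertificateReadoutVLandN
import Summits.NavierStokesRegularity.NavierStokesRegularity.Theorems.TaylorModelRungThreeCertificateReadoutVStepWinPSound

/-!
# Crux K1b-DR (stmt-NavierStokesRegularity-23954), line `taylor-model` — v3 read-outs, K-SIDE part 4-WPN: the windowed read-out step with
# the Poincaré-corrected base landing, RE-POINTED AT THE FULL-PRECISION RECIPROCALS — `readoutStepWinPN : ROInWinP → ROOutWin`
# (engine-1 g70; successor of `readoutStepWinP` of ns-tm-g4 g6, same input/output records, same semantic target `ReadoutsVP`)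

What changes w.r.t. `…ReadoutVStepWinP`: the two tests that contain a reciprocal are evaluated with the kernels of `…ReadoutVLandN`:
* `testR9pN` — `mag(W_l·landBoxN(Z0c) − ctr_l) + (Σ_c mag((W_l·[DLN(Z1)]·[PSN(Z1)]·[MinW])_c)·ρ0_c)↑ + β_l↑ + s_l↑ ≤ rad_l↓`
  (+ `landOK Z0c`, `landOK Z1`, `psOK`);
* `testR11N` (R11 on `Z1` with `[DLN]·[PSN]·[V]`);
everything else (winOK, node R5, fat R7, level-1 window ends, centre window ends, R8 on Z1) and the output record
(`Y0, Y1, Z0 := Z0c, Z1, VB := VBw`) VERBATIM.  Why: `invPos` keeps 1–2 significant bits on 64-bit mantissas, which made the measured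
`cenC` a factor `≈ 3·10⁸` above the slack on data whose true base-landing defect is `≲ 10⁻¹²` (module docstring of `…ReadoutVLandN`).

Contents: `ROInWin.M0N` (the kernel box `[DLN(Z1)]·[PSN(Z1)]·[MinW]`), the MEASUREMENT `diagR9pN`/`diagR9pNOK` (+ checkpoint forms
`CertTablesV.checkReadoutStageWinDiagPN'/…DiagPNOK'`, successor of `…ReadoutVDiagWinP` for the replay driver), `testR9pN`, `readoutStepWinPN`, `readoutStepWinPN_ok/_Z0/_Z1/_VB`, **`testR9pN_sound`**, `readoutStepWinPN_R9p`,
`readoutStepWinPN_R5c`, and the per-clause one-liners `readoutStepWinPN_win/_R5/_R7/_R5w1/_R8/_R11` (as `…StepWinPSound`).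

HONEST FRAMING: kernel bookkeeping for the MODEL certificate №23954 (rung TL-M3); nothing here is a statement about the
Navier–Stokes equations.
-/

-- the sub-problem namespace repeats the summit name by design (D-0017)
set_option linter.dupNamespace false

namespace Summit.NavierStokesRegularity.NavierStokesRegularity.Theorems.TaylorModelCert

open scoped BigOperators
open Set
open Literature.Analysis.FluidPDE.TaoCascade Literature.Analysis.FluidPDE.TaoCascade.TaylorChain

namespace ROInWin

variable {K : Type} [Field K] (T : CertTables K) (rw : ROInWin)

/-- The Poincaré-corrected displacement kernel box with full-precision reciprocals `[DLN(Z¹)]·[PSN(Z¹)]·[MinW]`. [folklore] -/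
def M0N : Array (Array IntervalD) :=
  mulII T.n rw.base.prec
    (mulII T.n rw.base.prec (T.dlBoxN rw.base.prec rw.base.LvB rw.base.tv (rw.Z1 T)) (T.psBoxN rw.base.prec rw.base.Wσ (rw.Fw T)))
    (rw.MinW T)

end ROInWin

namespace CertTables

variable {K : Type} [Field K]

/-- **(R9p) numbers per face, full-precision reciprocals** `l < nF`: `(cenC_l, mv_l, slack_l)` with `landBoxN` and `M0N`;
`ρ0` = the level-0 hull radii at node `S−1`. [folklore] -/
def diagR9pN (T : CertTables K) (rw : ROInWin) (ρ0 : Array Dyad) : Array (Dyad × Dyad × Dyad) :=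
  let ri := rw.base
  let LB0 := T.landBoxN ri.prec ri.LvB ri.tv (rw.Z0c T)
  let M := rw.M0N T
  Array.ofFn fun l : Fin ri.nF =>
    let Wl := IntervalD.lget ri.WJ l
    let cenC := IntervalD.mag (IntervalD.subR ri.prec
      (IntervalD.rangeSumR ri.prec (fun c => IntervalD.mulR ri.prec (IntervalD.aget Wl c) (IntervalD.aget LB0 c)) T.n)
      (IntervalD.aget ri.ctrB l))
    let C := IntervalD.covMulIM T.n ri.prec Wl M
    let mv := (IntervalD.rangeSumR ri.prec (fun c => IntervalD.mulR ri.prec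
      (IntervalD.ofDyad (IntervalD.mag (IntervalD.aget C c))) (IntervalD.ofDyad (dget ρ0 c))) T.n).hi
    let slack := Dyad.sub (Dyad.sub (IntervalD.aget ri.radB l).lo (IntervalD.aget ri.sB l).hi) (IntervalD.aget ri.βB l).hi
    (cenC, mv, slack)

/-- **(R9p) as a Boolean, full-precision reciprocals** (measurement only): structural `landOK` of both boxes, `psOK`, and
`cenC_l + mv_l ≤ slack_l` for all faces. [folklore] -/
def diagR9pNOK (T : CertTables K) (rw : ROInWin) (ρ0 : Array Dyad) : Bool :=
  let ri := rw.base
  T.landOK (rw.Z0c T) && T.landOK (rw.Z1 T) && T.psOK ri.prec ri.Wσ (rw.Fw T) &&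
  (T.diagR9pN rw ρ0).all fun t => Dyad.ble (Dyad.add t.1 t.2.1) t.2.2

end CertTables

namespace CertTables

variable {K : Type} [Field K]

/-- **(R9p) TEST with full-precision reciprocals** per face `l < nF` (see the module docstring). [folklore] -/
def testR9pN (T : CertTables K) (rw : ROInWin) (ρ0 : Array Dyad) : Bool :=
  let ri := rw.base
  let LB0 := T.landBoxN ri.prec ri.LvB ri.tv (rw.Z0c T)
  let M := rw.M0N T
  T.landOK (rw.Z0c T) && T.landOK (rw.Z1 T) && T.psOK ri.prec ri.Wσ (rw.Fw T) &&
  allN ri.nF fun l =>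
    let Wl := IntervalD.lget ri.WJ l
    let C := IntervalD.covMulIM T.n ri.prec Wl M
    Dyad.ble
      (Dyad.add (Dyad.add (Dyad.add
        (IntervalD.mag (IntervalD.subR ri.prec
          (IntervalD.rangeSumR ri.prec (fun c => IntervalD.mulR ri.prec (IntervalD.aget Wl c) (IntervalD.aget LB0 c)) T.n)
          (IntervalD.aget ri.ctrB l)))
        (IntervalD.rangeSumR ri.prec (fun c => IntervalD.mulR ri.prec
          (IntervalD.ofDyad (IntervalD.mag (IntervalD.aget C c))) (IntervalD.ofDyad (dget ρ0 c))) T.n).hi)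
        (IntervalD.aget ri.βB l).hi) (IntervalD.aget ri.sB l).hi)
      (IntervalD.aget ri.radB l).lo

/-- **The windowed read-out step with Poincaré-corrected base landing, full-precision reciprocals.** [folklore] -/
def readoutStepWinPN (T : CertTables K) (rp : ROInWinP) : ROOutWin :=
  let rw := rp.win
  let ri := rw.base
  { ok := winOK rw.u0lo rw.u0hi rw.u1lo rw.u1hi ri.h &&
          T.testR5 ri.prec ri.Wσ ri.LB ri.H1 ri.Ha1 && T.testR7 ri.coefB ri.prec ri.mt ri.Wσ ri.GB (ri.Y1 T) &&
          T.testR5 ri.prec ri.Wσ ri.LB (rw.Z1a T) (rw.Z1b T) && T.testR5 ri.prec ri.Wσ ri.LB (rw.Z0ca T) (rw.Z0cb T) &&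
          T.testR8 ri.ASB ri.AK ri.rlo (rw.Z1 T) && T.testR9pN rw rp.ρ0 &&
          T.testR11N ri.prec ri.nF ri.WJ ri.G ri.rPB ri.βB ri.ρ ri.LvB ri.tv (rw.Z1 T) ri.Wσ (rw.Fw T) (rw.VBw T)
    Y0 := ri.Y0 T, Y1 := ri.Y1 T, Z0 := rw.Z0c T, Z1 := rw.Z1 T, VB := rw.VBw T }

variable (T : CertTables K) (rp : ROInWinP)

omit [Field K] in
/-- The verdict unfolds to the eight tests. [folklore] -/
theorem readoutStepWinPN_ok (h : (T.readoutStepWinPN rp).ok = true) :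
    winOK rp.win.u0lo rp.win.u0hi rp.win.u1lo rp.win.u1hi rp.win.base.h = true ∧
    T.testR5 rp.win.base.prec rp.win.base.Wσ rp.win.base.LB rp.win.base.H1 rp.win.base.Ha1 = true ∧
    T.testR7 rp.win.base.coefB rp.win.base.prec rp.win.base.mt rp.win.base.Wσ rp.win.base.GB (rp.win.base.Y1 T) = true ∧
    T.testR5 rp.win.base.prec rp.win.base.Wσ rp.win.base.LB (rp.win.Z1a T) (rp.win.Z1b T) = true ∧
    T.testR5 rp.win.base.prec rp.win.base.Wσ rp.win.base.LB (rp.win.Z0ca T) (rp.win.Z0cb T) = true ∧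
    T.testR8 rp.win.base.ASB rp.win.base.AK rp.win.base.rlo (rp.win.Z1 T) = true ∧ T.testR9pN rp.win rp.ρ0 = true ∧
    T.testR11N rp.win.base.prec rp.win.base.nF rp.win.base.WJ rp.win.base.G rp.win.base.rPB rp.win.base.βB rp.win.base.ρ
      rp.win.base.LvB rp.win.base.tv (rp.win.Z1 T) rp.win.base.Wσ (rp.win.Fw T) (rp.win.VBw T) = true := by
  have h' : (winOK rp.win.u0lo rp.win.u0hi rp.win.u1lo rp.win.u1hi rp.win.base.h &&
      T.testR5 rp.win.base.prec rp.win.base.Wσ rp.win.base.LB rp.win.base.H1 rp.win.base.Ha1 &&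
      T.testR7 rp.win.base.coefB rp.win.base.prec rp.win.base.mt rp.win.base.Wσ rp.win.base.GB (rp.win.base.Y1 T) &&
      T.testR5 rp.win.base.prec rp.win.base.Wσ rp.win.base.LB (rp.win.Z1a T) (rp.win.Z1b T) &&
      T.testR5 rp.win.base.prec rp.win.base.Wσ rp.win.base.LB (rp.win.Z0ca T) (rp.win.Z0cb T) &&
      T.testR8 rp.win.base.ASB rp.win.base.AK rp.win.base.rlo (rp.win.Z1 T) && T.testR9pN rp.win rp.ρ0 &&
      T.testR11N rp.win.base.prec rp.win.base.nF rp.win.base.WJ rp.win.base.G rp.win.base.rPB rp.win.base.βB rp.win.base.ρ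
        rp.win.base.LvB rp.win.base.tv (rp.win.Z1 T) rp.win.base.Wσ (rp.win.Fw T) (rp.win.VBw T)) = true := h
  simp only [Bool.and_eq_true] at h'
  obtain ⟨⟨⟨⟨⟨⟨⟨hw, h5⟩, h7⟩, h5a⟩, h5c⟩, h8⟩, h9⟩, h11⟩ := h'
  exact ⟨hw, h5, h7, h5a, h5c, h8, h9, h11⟩

omit [Field K] in
/-- [folklore] -/ theorem readoutStepWinPN_Z0 : (T.readoutStepWinPN rp).Z0 = rp.win.Z0c T := rfl
omit [Field K] in
/-- [folklore] -/ theorem readoutStepWinPN_Z1 : (T.readoutStepWinPN rp).Z1 = rp.win.Z1 T := rfl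
omit [Field K] in
/-- [folklore] -/ theorem readoutStepWinPN_VB : (T.readoutStepWinPN rp).VB = rp.win.VBw T := rfl
omit [Field K] in
/-- [folklore] -/ theorem readoutStepWinPN_Y0 : (T.readoutStepWinPN rp).Y0 = rp.win.base.Y0 T := rfl
omit [Field K] in
/-- [folklore] -/ theorem readoutStepWinPN_Y1 : (T.readoutStepWinPN rp).Y1 = rp.win.base.Y1 T := rfl

/-! ### Soundness of the (R9p) test with full-precision reciprocals -/

variable {φ : K →+* ℝ}

/-- **Soundness of (R9p), full-precision reciprocals** in coordinates (hypotheses read exactly as in `testR9p_sound`):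
`|covR φ (w l) (landF Lv yc v) − ctr_l| + |Σ_a φ(w_{l,a})·wv (landDF Lv y₁ v (secCorrF wσ q z)) a| + β_l ≤ rad_l − s_l`. [folklore] -/
theorem testR9pN_sound {rw : ROInWin} {ρ0 : Array Dyad} (h : T.testR9pN rw ρ0 = true)
    {w : ℕ → List K} (hW : ∀ l < rw.base.nF, ∀ a < T.n, IntervalD.mem (φ (vget (w l) a)) (IntervalD.aget (IntervalD.lget rw.base.WJ l) a))
    {ctr β s rad : ℕ → ℝ} (hctr : ∀ l < rw.base.nF, IntervalD.mem (ctr l) (IntervalD.aget rw.base.ctrB l))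
    (hβ : ∀ l < rw.base.nF, IntervalD.mem (β l) (IntervalD.aget rw.base.βB l))
    (hs : ∀ l < rw.base.nF, IntervalD.mem (s l) (IntervalD.aget rw.base.sB l))
    (hrad : ∀ l < rw.base.nF, IntervalD.mem (rad l) (IntervalD.aget rw.base.radB l))
    {Lv : ℝ} (hLv : IntervalD.mem Lv rw.base.LvB) {v : Fin 4 → ℝ} (hv : ∀ i, |v i| ≤ rw.base.tv.toReal)
    {yc : Fin 4 → ℤ → ℝ} (hyc : MemVec T.n (T.wv yc) (rw.Z0c T))
    {y₁ : Fin 4 → ℤ → ℝ} (hy₁ : MemVec T.n (T.wv y₁) (rw.Z1 T))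
    {wσ : List K} (hWσ : ∀ b < T.n, IntervalD.mem (φ (vget wσ b)) (IntervalD.aget rw.base.Wσ b))
    {q : Fin 4 → ℤ → ℝ} (hq : MemVec T.n (T.wv q) (rw.Fw T))
    {a : ℕ → ℕ → ℝ} (ha : MemMat T.n a (rw.MinW T))
    {d : ℕ → ℝ} (hρ : ∀ c < T.n, |d c| ≤ (dget ρ0 c).toReal)
    {z : Fin 4 → ℤ → ℝ} (hz : ∀ b < T.n, T.wv z b = ∑ c ∈ Finset.range T.n, a b c * d c)
    {l : ℕ} (hl : l < rw.base.nF) :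
    |T.covR φ (w l) (T.landF Lv yc v) - ctr l| +
      |∑ a' ∈ Finset.range T.n, φ (vget (w l) a') * T.wv (T.landDF Lv y₁ v (T.secCorrF φ wσ q z)) a'| + β l ≤ rad l - s l := by
  unfold testR9pN at h
  simp only [Bool.and_eq_true] at h
  obtain ⟨⟨⟨hok0, hok1⟩, hps⟩, hall⟩ := h
  have h1 : -T.Kb ≤ 1 ∧ (1 : ℤ) ≤ T.Ka := by
    have := hok1; simp only [landOK, Bool.and_eq_true, decide_eq_true_eq] at this; exact this.1
  have hb := (allN_eq_true.1 hall) l hl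
  simp only [Dyad.ble_iff, Dyad.toReal_add] at hb
  -- first term: the centre landing on the centre-only box
  have hland := T.mem_landF_landBoxN hok0 rw.base.prec hLv hv hyc
  have hdot : IntervalD.mem (T.covR φ (w l) (T.landF Lv yc v))
      (IntervalD.rangeSumR rw.base.prec (fun c => IntervalD.mulR rw.base.prec (IntervalD.aget (IntervalD.lget rw.base.WJ l) c)
        (IntervalD.aget (T.landBoxN rw.base.prec rw.base.LvB rw.base.tv (rw.Z0c T)) c)) T.n) := by
    rw [T.covR_apply φ (w l)]
    exact IntervalD.mem_rangeSumR rw.base.prec T.n fun c hc => IntervalD.mem_mulR rw.base.prec (hW l hl c hc) (hland c hc)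
  have hmag := IntervalD.abs_le_mag (IntervalD.mem_subR rw.base.prec hdot (hctr l hl))
  -- second term: the covector `W_l·[DLN]·[PSN]·[MinW]` applied to `d`
  have hDL := T.memMat_dlBoxN hok1 rw.base.prec hLv hv hy₁
  have hPS := T.memMat_psBoxN rw.base.prec hWσ hq hps
  have hM : MemMat T.n _ (rw.M0N T) := memMat_mulII rw.base.prec (memMat_mulII rw.base.prec hDL hPS) ha
  have hcoord : ∀ a' < T.n, T.wv (T.landDF Lv y₁ v (T.secCorrF φ wσ q z)) a'
      = ∑ c ∈ Finset.range T.n,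
          (∑ b' ∈ Finset.range T.n, (∑ b ∈ Finset.range T.n, T.dlMat Lv y₁ v a' b * T.psMat φ wσ q b b') * a b' c) * d c := by
    intro a' ha'
    rw [T.wv_landDF h1 Lv y₁ v _ ha']
    have : ∑ c' ∈ Finset.range T.n, T.dlMat Lv y₁ v a' c' * T.wv (T.secCorrF φ wσ q z) c'
        = ∑ b ∈ Finset.range T.n, T.dlMat Lv y₁ v a' b * ∑ b' ∈ Finset.range T.n, T.psMat φ wσ q b b' * ∑ c ∈ Finset.range T.n, a b' c * d c := by
      refine Finset.sum_congr rfl fun b hb' => ?_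
      rw [T.wv_secCorrF wσ q z (Finset.mem_range.1 hb')]
      congr 1
      exact Finset.sum_congr rfl fun b' hb'' => by rw [hz b' (Finset.mem_range.1 hb'')]
    rw [this, triple_eq_row]
  have hrow : ∑ a' ∈ Finset.range T.n, φ (vget (w l) a') * T.wv (T.landDF Lv y₁ v (T.secCorrF φ wσ q z)) a'
      = ∑ c ∈ Finset.range T.n, (∑ a' ∈ Finset.range T.n, φ (vget (w l) a') *
          (∑ b' ∈ Finset.range T.n, (∑ b ∈ Finset.range T.n, T.dlMat Lv y₁ v a' b * T.psMat φ wσ q b b') * a b' c)) * d c := by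
    rw [← bilin_eq_row]
    exact Finset.sum_congr rfl fun a' ha' => by rw [hcoord a' (Finset.mem_range.1 ha')]
  rw [hrow]
  have hC := fun c (hc : c < T.n) => IntervalD.mem_covMulIM rw.base.prec (hW l hl) hM hc
  have hcov := abs_cov_le rw.base.prec hC hρ
  have hb' : (IntervalD.mag (IntervalD.subR rw.base.prec
        (IntervalD.rangeSumR rw.base.prec (fun c => IntervalD.mulR rw.base.prec (IntervalD.aget (IntervalD.lget rw.base.WJ l) c)
          (IntervalD.aget (T.landBoxN rw.base.prec rw.base.LvB rw.base.tv (rw.Z0c T)) c)) T.n)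
        (IntervalD.aget rw.base.ctrB l))).toReal +
      (IntervalD.rangeSumR rw.base.prec (fun c => IntervalD.mulR rw.base.prec
        (IntervalD.ofDyad (IntervalD.mag (IntervalD.aget (IntervalD.covMulIM T.n rw.base.prec (IntervalD.lget rw.base.WJ l) (rw.M0N T)) c)))
        (IntervalD.ofDyad (dget ρ0 c))) T.n).hi.toReal +
      (IntervalD.aget rw.base.βB l).hi.toReal + (IntervalD.aget rw.base.sB l).hi.toReal ≤ (IntervalD.aget rw.base.radB l).lo.toReal := hb
  linarith [hmag, hcov, hb', (hβ l hl).2, (hs l hl).2, (hrad l hl).1]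

/-- **(R9p)** from the N step. [folklore] -/
theorem readoutStepWinPN_R9p (hok : (T.readoutStepWinPN rp).ok = true)
    {w : ℕ → List K} (hW : ∀ l < rp.win.base.nF, ∀ a < T.n, IntervalD.mem (φ (vget (w l) a)) (IntervalD.aget (IntervalD.lget rp.win.base.WJ l) a))
    {ctr β s rad : ℕ → ℝ} (hctr : ∀ l < rp.win.base.nF, IntervalD.mem (ctr l) (IntervalD.aget rp.win.base.ctrB l))
    (hβ : ∀ l < rp.win.base.nF, IntervalD.mem (β l) (IntervalD.aget rp.win.base.βB l))
    (hs : ∀ l < rp.win.base.nF, IntervalD.mem (s l) (IntervalD.aget rp.win.base.sB l))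
    (hrad : ∀ l < rp.win.base.nF, IntervalD.mem (rad l) (IntervalD.aget rp.win.base.radB l))
    {Lv : ℝ} (hLv : IntervalD.mem Lv rp.win.base.LvB) {v : Fin 4 → ℝ} (hv : ∀ i, |v i| ≤ rp.win.base.tv.toReal)
    {yc : Fin 4 → ℤ → ℝ} (hyc : MemVec T.n (T.wv yc) (rp.win.Z0c T))
    {y₁ : Fin 4 → ℤ → ℝ} (hy₁ : MemVec T.n (T.wv y₁) (rp.win.Z1 T))
    {wσ : List K} (hWσ : ∀ b < T.n, IntervalD.mem (φ (vget wσ b)) (IntervalD.aget rp.win.base.Wσ b))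
    (hco : T.CoefOK φ) (hcB : CoefBoxOK φ T rp.win.base.coefB) (hmt : rp.win.base.mt = T.monosTable rp.win.base.coefB)
    {a : ℕ → ℕ → ℝ} (ha : MemMat T.n a (rp.win.MinW T))
    {d : ℕ → ℝ} (hρ : ∀ c < T.n, |d c| ≤ (dget rp.ρ0 c).toReal)
    {z : Fin 4 → ℤ → ℝ} (hz : ∀ b < T.n, T.wv z b = ∑ c ∈ Finset.range T.n, a b c * d c)
    {l : ℕ} (hl : l < rp.win.base.nF) :
    |T.covR φ (w l) (T.landF Lv yc v) - ctr l| +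
      |∑ a' ∈ Finset.range T.n, φ (vget (w l) a') *
        T.wv (T.landDF Lv y₁ v (T.secCorrF φ wσ ((T.toCertData φ).Qb y₁ y₁) z)) a'| + β l ≤ rad l - s l := by
  obtain ⟨_, _, _, _, _, _, h9, _⟩ := T.readoutStepWinPN_ok rp hok
  have hFE : IntervalD.IsFieldEnclosureA T.wv (qBf (T.toCertData φ)) T.n (T.qBboxMA rp.win.base.coefB rp.win.base.prec rp.win.base.mt) := by
    rw [hmt]; exact T.isFieldEnclosureA_qBboxMA hco hcB rp.win.base.prec
  have hq : MemVec T.n (T.wv ((T.toCertData φ).Qb y₁ y₁)) (rp.win.Fw T) := by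
    intro c hc
    rw [T.Qb_diag_eq_qBf]
    exact hFE _ _ y₁ y₁ (T.size_Z1 rp.win) (T.size_Z1 rp.win) hy₁ hy₁ c hc
  exact T.testR9pN_sound h9 hW hctr hβ hs hrad hLv hv hyc hy₁ hWσ hq ha hρ hz hl

/-- **Centre window-end section tests** from the N step: `σf < lev` on `Z0ca`, `lev < σf` on `Z0cb`. [folklore] -/
theorem readoutStepWinPN_R5c (hok : (T.readoutStepWinPN rp).ok = true) {wσ : List K}
    (hW : ∀ c < T.n, IntervalD.mem (φ (vget wσ c)) (IntervalD.aget rp.win.base.Wσ c)) {lev : ℝ} (hL : IntervalD.mem lev rp.win.base.LB) :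
    (∀ y : Fin 4 → ℤ → ℝ, MemVec T.n (T.wv y) (rp.win.Z0ca T) → T.covR φ wσ y < lev) ∧
    (∀ y : Fin 4 → ℤ → ℝ, MemVec T.n (T.wv y) (rp.win.Z0cb T) → lev < T.covR φ wσ y) :=
  T.testR5_sound hW hL (T.readoutStepWinPN_ok rp hok).2.2.2.2.1

/-! ### Per-clause one-liners (as `…ReadoutVStepWinPSound`) -/

omit [Field K] in
/-- **Window order** from the N step. [folklore] -/
theorem readoutStepWinPN_win (hok : (T.readoutStepWinPN rp).ok = true) :
    0 ≤ rp.win.u1lo.toReal ∧ rp.win.u1lo.toReal ≤ rp.win.u0lo.toReal ∧ rp.win.u0lo.toReal ≤ rp.win.u0hi.toReal ∧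
      rp.win.u0hi.toReal ≤ rp.win.u1hi.toReal ∧ rp.win.u1hi.toReal ≤ rp.win.base.h.toReal :=
  winOK_sound (T.readoutStepWinPN_ok rp hok).1

/-- **(R5)** (at the nodes) from the N step. [folklore] -/
theorem readoutStepWinPN_R5 (hok : (T.readoutStepWinPN rp).ok = true) {wσ : List K}
    (hW : ∀ c < T.n, IntervalD.mem (φ (vget wσ c)) (IntervalD.aget rp.win.base.Wσ c)) {lev : ℝ} (hL : IntervalD.mem lev rp.win.base.LB) :
    (∀ y : Fin 4 → ℤ → ℝ, MemVec T.n (T.wv y) rp.win.base.H1 → T.covR φ wσ y < lev) ∧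
    (∀ y : Fin 4 → ℤ → ℝ, MemVec T.n (T.wv y) rp.win.base.Ha1 → lev < T.covR φ wσ y) :=
  T.testR5_sound hW hL (T.readoutStepWinPN_ok rp hok).2.1

/-- **(R7)** on the fat level-1 box from the N step. [folklore] -/
theorem readoutStepWinPN_R7 (hco : T.CoefOK φ) (hcB : CoefBoxOK φ T rp.win.base.coefB) (hmt : rp.win.base.mt = T.monosTable rp.win.base.coefB)
    (hok : (T.readoutStepWinPN rp).ok = true) {wσ : List K} (hW : ∀ c < T.n, IntervalD.mem (φ (vget wσ c)) (IntervalD.aget rp.win.base.Wσ c))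
    {γ : ℝ} (hG : IntervalD.mem γ rp.win.base.GB) :
    ∀ y : Fin 4 → ℤ → ℝ, MemVec T.n (T.wv y) (rp.win.base.Y1 T) → γ ≤ T.covR φ wσ ((T.toCertData φ).Qb y y) :=
  T.testR7_sound hco hcB hmt hW hG (T.size_Y1 rp.win.base) (T.readoutStepWinPN_ok rp hok).2.2.1

/-- **Level-1 window-end section tests** from the N step. [folklore] -/
theorem readoutStepWinPN_R5w1 (hok : (T.readoutStepWinPN rp).ok = true) {wσ : List K}
    (hW : ∀ c < T.n, IntervalD.mem (φ (vget wσ c)) (IntervalD.aget rp.win.base.Wσ c)) {lev : ℝ} (hL : IntervalD.mem lev rp.win.base.LB) :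
    (∀ y : Fin 4 → ℤ → ℝ, MemVec T.n (T.wv y) (rp.win.Z1a T) → T.covR φ wσ y < lev) ∧
    (∀ y : Fin 4 → ℤ → ℝ, MemVec T.n (T.wv y) (rp.win.Z1b T) → lev < T.covR φ wσ y) :=
  T.testR5_sound hW hL (T.readoutStepWinPN_ok rp hok).2.2.2.1

omit [Field K] in
/-- **(R8)** on `Z1` from the N step. [folklore] -/
theorem readoutStepWinPN_R8 (hok : (T.readoutStepWinPN rp).ok = true) {as aK R : ℝ} (has : IntervalD.mem as rp.win.base.ASB)
    (haK : IntervalD.mem aK rp.win.base.AK) (hR : rp.win.base.rlo.toReal ≤ R) :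
    ∀ y : Fin 4 → ℤ → ℝ, MemVec T.n (T.wv y) (rp.win.Z1 T) → as ≤ |y T.i₀ 1| ∧ ∀ i, |y i (-T.Kb)| + aK ≤ R :=
  T.testR8_sound (T.readoutStepWinPN_ok rp hok).2.2.2.2.2.1 has haK hR

/-- **(R11)** on `Z1` from the N step (hypotheses as `readoutStepWinP_R11`). [folklore] -/
theorem readoutStepWinPN_R11 (hco : T.CoefOK φ) (hcB : CoefBoxOK φ T rp.win.base.coefB) (hmt : rp.win.base.mt = T.monosTable rp.win.base.coefB)
    (hok : (T.readoutStepWinPN rp).ok = true)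
    {w : ℕ → List K} (hW : ∀ l < rp.win.base.nF, ∀ a < T.n, IntervalD.mem (φ (vget (w l) a)) (IntervalD.aget (IntervalD.lget rp.win.base.WJ l) a))
    {g : ℕ → ℕ → ℝ} (hG : ∀ l < rp.win.base.nF, ∀ c < T.n, IntervalD.mem (g l c) (IntervalD.aget (IntervalD.lget rp.win.base.G l) c))
    {rP β : ℕ → ℝ} (hrP : ∀ l < rp.win.base.nF, IntervalD.mem (rP l) (IntervalD.aget rp.win.base.rPB l))
    (hβ : ∀ l < rp.win.base.nF, IntervalD.mem (β l) (IntervalD.aget rp.win.base.βB l))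
    {Lv : ℝ} (hLv : IntervalD.mem Lv rp.win.base.LvB) {v : Fin 4 → ℝ} (hv : ∀ i, |v i| ≤ rp.win.base.tv.toReal)
    {y : Fin 4 → ℤ → ℝ} (hy : MemVec T.n (T.wv y) (rp.win.Z1 T))
    {wσ : List K} (hWσ : ∀ b < T.n, IntervalD.mem (φ (vget wσ b)) (IntervalD.aget rp.win.base.Wσ b))
    {vm : ℕ → ℕ → ℝ} (hV : MemMat T.n vm (rp.win.VBw T))
    {ζ : ℕ → ℝ} (hρ : ∀ c < T.n, |ζ c| ≤ (dget rp.win.base.ρ c).toReal)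
    (hface : ∀ l < rp.win.base.nF, |∑ c ∈ Finset.range T.n, g l c * ζ c| ≤ rP l)
    {z : Fin 4 → ℤ → ℝ} (hz : ∀ b < T.n, T.wv z b = ∑ c ∈ Finset.range T.n, vm b c * ζ c)
    {l : ℕ} (hl : l < rp.win.base.nF) :
    |∑ a ∈ Finset.range T.n, φ (vget (w l) a) * T.wv (T.landDF Lv y v (T.secCorrF φ wσ ((T.toCertData φ).Qb y y) z)) a| ≤ β l := by
  obtain ⟨_, _, _, _, _, _, _, h11⟩ := T.readoutStepWinPN_ok rp hok
  have hFE : IntervalD.IsFieldEnclosureA T.wv (qBf (T.toCertData φ)) T.n (T.qBboxMA rp.win.base.coefB rp.win.base.prec rp.win.base.mt) := by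
    rw [hmt]; exact T.isFieldEnclosureA_qBboxMA hco hcB rp.win.base.prec
  have hq : MemVec T.n (T.wv ((T.toCertData φ).Qb y y)) (rp.win.Fw T) := by
    intro c hc
    rw [T.Qb_diag_eq_qBf]
    exact hFE _ _ y y (T.size_Z1 rp.win) (T.size_Z1 rp.win) hy hy c hc
  exact T.testR11N_sound h11 hW hG hrP hβ hLv hv hy hWσ hq hV hρ hface hz hl

end CertTables

namespace CertTablesV

variable (TV : CertTablesV) (kitOf : ℕ → CoreKit) (wT : ℕ → Array Dyad) (A : ReadoutAux QS2) (WV : WindowsV)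

/-- Per-stage (R9p) numbers with full-precision reciprocals (checkpoint form). [folklore] -/
def checkReadoutStageWinDiagPN' (j : ℕ) : Array (Dyad × Dyad × Dyad) :=
  TV.base.diagR9pN (TV.roInWin' kitOf wT A WV j) (TV.rho0' kitOf wT j)

/-- Per-stage (R9p) Boolean with full-precision reciprocals (measurement only; checkpoint form). [folklore] -/
def checkReadoutStageWinDiagPNOK' (j : ℕ) : Bool :=
  TV.base.diagR9pNOK (TV.roInWin' kitOf wT A WV j) (TV.rho0' kitOf wT j)

end CertTablesV

end Summit.NavierStokesRegularity.NavierStokesRegularity.Theorems.TaylorModelCert
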